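import Summits.AtomisticToContinuum.HydrodynamicLimit.Theorems.AntiMazurCoboundariesInfluenceLocalityObjects
import Literature.MathematicalPhysics.KineticTheory.HardSphereCanonicalPairBound
import HarnessLib

/-!
# Static necklaces under `G_N` (prelim 2/2 of stub `stub_tightChainPressure`, line
# `true-anchored-infection`, crux `InfluenceLocality`, stmt-AtomisticToContinuum-13916)

This file is INDEPENDENT of prelim 1/2 (`…TightChainPressurePrelim`, the Ruelle-type chain bound
`gibbs_chainEventAt_bound`): it takes that fixed-time chain bound as the hypothesis `hchain` (verbatim its
instance at `σ, a, θ, u₀, N, K, Φ, t`), so that the two prelims land in either order; the unconditional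
necklace bound is `gibbs_necklaceAt_le_of_chainBound … (gibbs_chainEventAt_bound σ a θ u₀ h ha hθ N K hK Φ t)`.

* `gibbs_necklaceAt_le_of_chainBound` (registered): for `0 ≤ σ`, any `a, θ, u₀`, `N, K`, flow `Φ`, time
  `t`, radius `r < 1/2`, GIVEN the chain bound at time `t`, for every end label `i` the `G_N`-probability
  that `K + 1` DISTINCT particles `j 0, …, j K = i` have consecutive minimal-image distances `≤ r` at time
  `t` is at most `(N+1)^K · 2^{K+1} · (v₁ (r³ − ε_N³))^K`: on the conull good set the time-`t`
  configuration is non-overlapping, so every link displacement lies in the shell `[ε_N, r]`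
  (`volume_shell_le`), and the chain bound applies to each of the `≤ (N+1)^K` label sequences
  (`card_le_pow_of_last_eq`);
* `gibbs_tightNecklaceAt_le_of_chainBound`: its contact-scale form — with `r = ε_N (1 + 1/(K+1))` (the static,
  single-grid-time sub-event of `IsTightChain`) the bound is `2 · (14 v₁ σ³/(K+1))^K` (`necklace_arith`:
  `(1+x)³ − 1 ≤ 7x`, `(N+1) ε_N³ = σ³`), i.e. a `G_N`-cost `≥ K log((K+1)/(14 v₁ σ³)) − log 2` per static
  necklace of `K` links, uniformly in `N ≥ K`, `t`, `Φ`, `i`;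
* `isTightChain_of_staticNecklace` (deterministic, SLACK CONCENTRATION): a static necklace of `K − 1` links
  at time `0` plus ONE last link carrying the whole `w`-slack `w · Tℓ` is a tight anchored `w`-chain
  (grid times `q = (0, …, 0, 1)`), so every particle within `≈ w T ℓ` (at time `Tℓ`) of the end of a
  single static necklace is a chain end — `≈ (4π/3)(wT)³` ends for the price of ONE necklace of cost
  `≈ K log(K/σ³)`; this is why no threshold `K ≥ C(σ,T,lam,δ)·(1 + w)` can make the registered
  `TightChainPressure` true (reported to the lead; the multi-time part of stub 6 is NOT addressed here).
-/

namespace Summit.AtomisticToContinuum.HydrodynamicLimit.Theorems.TrueAnchoredInfection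

open MeasureTheory ProbabilityTheory Finset Set
open scoped Classical ENNReal
open Literature.Analysis.FluidPDE Literature.MathematicalPhysics.KineticTheory
open Literature.MathematicalPhysics.StatisticalMechanics

noncomputable section

/-- The SHELL of minimal-image radii `[ε, r]` (displacements `u ∈ 𝕋³` with `ε ≤ d(u, 0) ≤ r`) is
measurable. -/
theorem measurableSet_shell (ε r : ℝ) :
    MeasurableSet {u : T3 | ε ≤ Torus.euclidDist u 0 ∧ Torus.euclidDist u 0 ≤ r} := by
  have hc : Continuous fun u : T3 => Torus.euclidDist u 0 := by
    simp_rw [euclidDist_eq_sqrt]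
    fun_prop
  exact (measurableSet_le measurable_const hc.measurable).inter (measurableSet_le hc.measurable measurable_const)

/-- The Haar measure of the shell is at most `v₁ (r³ − ε³)` (`r < 1/2`, `0 ≤ ε`; `v₁` = volume of the
unit ball of `ℝ³`). -/
theorem volume_shell_le {ε r : ℝ} (hε : 0 ≤ ε) (hr : r < 1 / 2) :
    volume {u : T3 | ε ≤ Torus.euclidDist u 0 ∧ Torus.euclidDist u 0 ≤ r}
      ≤ ENNReal.ofReal (v₁ * (r ^ 3 - ε ^ 3)) := by
  by_cases hεr : r < ε
  · have h0 : {u : T3 | ε ≤ Torus.euclidDist u 0 ∧ Torus.euclidDist u 0 ≤ r} = ∅ := by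
      ext u
      simp only [Set.mem_setOf_eq, Set.mem_empty_iff_false, iff_false, not_and, not_le]
      intro h1
      linarith
    rw [h0, measure_empty]
    exact bot_le
  push Not at hεr
  have hsub : {u : T3 | Torus.euclidDist u 0 < ε} ⊆ {u : T3 | Torus.euclidDist u 0 ≤ r} :=
    fun u hu => le_trans (le_of_lt hu) hεr
  have hshell : {u : T3 | ε ≤ Torus.euclidDist u 0 ∧ Torus.euclidDist u 0 ≤ r}
      = {u : T3 | Torus.euclidDist u 0 ≤ r} \ {u : T3 | Torus.euclidDist u 0 < ε} := by
    ext u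
    simp only [Set.mem_setOf_eq, Set.mem_sdiff, not_lt]
    tauto
  have hc : Continuous fun u : T3 => Torus.euclidDist u 0 := by
    simp_rw [euclidDist_eq_sqrt]
    fun_prop
  have hlt : MeasurableSet {u : T3 | Torus.euclidDist u 0 < ε} := measurableSet_lt hc.measurable measurable_const
  have hV : volume (Metric.ball (0 : EuclideanSpace ℝ (Fin 3)) 1) = ENNReal.ofReal v₁ := by
    rw [v₁, ENNReal.ofReal_toReal measure_ball_lt_top.ne]
  have hr0 : 0 ≤ r := hε.trans hεr
  rw [hshell, measure_sdiff hsub hlt.nullMeasurableSet (measure_ne_top _ _),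
    Torus.volume_euclidDist_le hr, Torus.volume_euclidDist_lt ((hεr.trans_lt hr)),
    Measure.addHaar_closedBall volume _ hr0, Measure.addHaar_ball volume _ hε, finrank_euclideanSpace,
    Fintype.card_fin, hV, ← ENNReal.ofReal_mul (pow_nonneg hr0 3), ← ENNReal.ofReal_mul (pow_nonneg hε 3)]
  have h3 : ε ^ 3 ≤ r ^ 3 := pow_le_pow_left₀ hε hεr 3
  calc ENNReal.ofReal (r ^ 3 * v₁) - ENNReal.ofReal (ε ^ 3 * v₁)
      = ENNReal.ofReal (r ^ 3 * v₁ - ε ^ 3 * v₁) := (ENNReal.ofReal_sub _ (by have := v₁_pos; positivity)).symm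
    _ = ENNReal.ofReal (v₁ * (r ^ 3 - ε ^ 3)) := by ring_nf
    _ ≤ _ := le_rfl

/-- A set of label sequences `j : Fin (K+1) → Fin (N+1)` with a common last label has at most
`(N+1)^K` elements. -/
theorem card_le_pow_of_last_eq (N K : ℕ) (i : Fin (N + 1)) {S : Finset (Fin (K + 1) → Fin (N + 1))}
    (hS : ∀ j ∈ S, j (Fin.last K) = i) : S.card ≤ (N + 1) ^ K := by
  have hcard : ((univ : Finset (Fin K → Fin (N + 1)))).card = (N + 1) ^ K := by
    rw [card_univ, Fintype.card_fun, Fintype.card_fin, Fintype.card_fin]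
  rw [← hcard]
  refine Finset.card_le_card_of_injOn (fun j => j ∘ Fin.castSucc) (fun _ _ => mem_univ _) ?_
  intro j hj j' hj' hjj'
  have hl : j (Fin.last K) = j' (Fin.last K) := by
    rw [hS j (Finset.mem_coe.1 hj), hS j' (Finset.mem_coe.1 hj')]
  funext m
  induction m using Fin.lastCases with
  | last => exact hl
  | cast m => exact congr_fun hjj' m

/-- **Static necklace bound under `G_N` at a fixed time, given the chain bound** (registered prelim 2/2
of `stub_tightChainPressure`). For `0 ≤ σ`, any flow `Φ`, time `t`, radius `r < 1/2`, the fixed-time chain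
bound `hchain` (= `gibbs_chainEventAt_bound σ a θ u₀ _ _ _ N K _ Φ t` of prelim 1/2) and end label `i`: the
`G_N`-probability that `K + 1` DISTINCT particles `j 0, …, j K = i` have consecutive minimal-image
distances `≤ r` at time `t` is at most `(N+1)^K · 2^{K+1} · (v₁ (r³ − ε_N³))^K` — on the conull good set
the time-`t` configuration is non-overlapping, so every link displacement lies in the shell `[ε_N, r]`,
and `hchain` applies to each of the `≤ (N+1)^K` label sequences. -/
theorem gibbs_necklaceAt_le_of_chainBound : ∀ (σ a θ : ℝ) (u₀ : V3), 0 ≤ σ → ∀ (N K : ℕ) (Φ : Flow σ N) (t r : ℝ), r < 1 / 2 → (∀ (j : Fin (K + 1) → Fin (N + 1)), Function.Injective j → ∀ (B : Fin K → Set T3), (∀ m, MeasurableSet (B m)) → gibbs σ a θ u₀ N Φ {z : Phase N | ∀ m : Fin K, (Φ.flow t z (j m.succ)).1 - (Φ.flow t z (j m.castSucc)).1 ∈ B m} ≤ 2 ^ (K + 1) * ∏ m, volume (B m)) → ∀ i : Fin (N + 1), gibbs σ a θ u₀ N Φ {z : Phase N | ∃ j : Fin (K + 1) → Fin (N + 1),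 Function.Injective j ∧ j (Fin.last K) = i ∧ ∀ m : Fin K, Torus.euclidDist (Φ.flow t z (j m.succ)).1 (Φ.flow t z (j m.castSucc)).1 ≤ r} ≤ ((N + 1 : ℕ) : ℝ≥0∞) ^ K * (2 ^ (K + 1) * ENNReal.ofReal (v₁ * (r ^ 3 - hsDiameter σ N ^ 3)) ^ K) := by
  intro σ a θ u₀ hσ N K Φ t r hr hchain i
  set G := gibbs σ a θ u₀ N Φ with hG
  set S : Finset (Fin (K + 1) → Fin (N + 1)) :=
    (univ : Finset (Fin (K + 1) → Fin (N + 1))).filter fun j => Function.Injective j ∧ j (Fin.last K) = i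
    with hS
  set E : (Fin (K + 1) → Fin (N + 1)) → Set (Phase N) := fun j =>
    {z | ∀ m : Fin K, (Φ.flow t z (j m.succ)).1 - (Φ.flow t z (j m.castSucc)).1 ∈ {u : T3 | hsDiameter σ N ≤ Torus.euclidDist u 0 ∧ Torus.euclidDist u 0 ≤ r}}
    with hEdef
  have hgood : ∀ᵐ z ∂G, z ∈ Φ.good := by
    rw [hG, gibbs, localGibbsLaw_eq]
    exact (localGibbsMeasure_absolutelyContinuous σ _ _ _ N Φ).ae_le Φ.ae_mem_good
  have hae : ∀ᵐ z ∂G, z ∈ {z : Phase N | ∃ j : Fin (K + 1) → Fin (N + 1), Function.Injective j ∧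
        j (Fin.last K) = i ∧ ∀ m : Fin K,
          Torus.euclidDist (Φ.flow t z (j m.succ)).1 (Φ.flow t z (j m.castSucc)).1 ≤ r}
      → z ∈ ⋃ j ∈ S, E j := by
    filter_upwards [hgood] with z hz hmem
    obtain ⟨j, hj, hji, hlink⟩ := hmem
    have hdom : Φ.flow t z ∈ hardSphereDomain G3 (N + 1) (hsDiameter σ N) :=
      Φ.good_subset (Φ.mapsTo_good t hz)
    refine Set.mem_biUnion (show j ∈ S from mem_filter.2 ⟨mem_univ _, hj, hji⟩) fun m => ?_
    have hne : j m.succ ≠ j m.castSucc := fun heq => m.castSucc_lt_succ.ne' (hj heq)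
    have hcore := mem_hardSphereDomain.1 hdom _ _ hne
    rw [Torus.norm_geometry_sepVec] at hcore
    have hd : Torus.euclidDist ((Φ.flow t z (j m.succ)).1 - (Φ.flow t z (j m.castSucc)).1) 0
        = Torus.euclidDist (Φ.flow t z (j m.succ)).1 (Φ.flow t z (j m.castSucc)).1 := by
      rw [Torus.euclidDist, Torus.euclidDist, sub_zero]
    exact ⟨hd ▸ hcore, hd ▸ hlink m⟩
  have hEj : ∀ j ∈ S, G (E j) ≤ 2 ^ (K + 1) * volume ({u : T3 | hsDiameter σ N ≤ Torus.euclidDist u 0 ∧ Torus.euclidDist u 0 ≤ r}) ^ K := by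
    intro j hj
    have hjinj : Function.Injective j := (mem_filter.1 hj).2.1
    have hb := hchain j hjinj (fun _ => {u : T3 | hsDiameter σ N ≤ Torus.euclidDist u 0 ∧ Torus.euclidDist u 0 ≤ r})
      fun _ => measurableSet_shell (hsDiameter σ N) r
    rwa [Finset.prod_const, card_univ, Fintype.card_fin] at hb
  calc G _ ≤ G (⋃ j ∈ S, E j) := measure_mono_ae hae
    _ ≤ ∑ j ∈ S, G (E j) := measure_biUnion_finset_le S E
    _ ≤ ∑ _j ∈ S, 2 ^ (K + 1) * volume ({u : T3 | hsDiameter σ N ≤ Torus.euclidDist u 0 ∧ Torus.euclidDist u 0 ≤ r}) ^ K := Finset.sum_le_sum hEj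
    _ = (S.card : ℝ≥0∞) * (2 ^ (K + 1) * volume ({u : T3 | hsDiameter σ N ≤ Torus.euclidDist u 0 ∧ Torus.euclidDist u 0 ≤ r}) ^ K) := by
        rw [Finset.sum_const, nsmul_eq_mul]
    _ ≤ ((N + 1 : ℕ) : ℝ≥0∞) ^ K *
        (2 ^ (K + 1) * ENNReal.ofReal (v₁ * (r ^ 3 - hsDiameter σ N ^ 3)) ^ K) := by
        gcongr
        · have hc : S.card ≤ (N + 1) ^ K :=
            card_le_pow_of_last_eq N K i fun j hj => (mem_filter.1 hj).2.2
          exact_mod_cast hc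
        · exact volume_shell_le (hsDiameter_nonneg' hσ N) hr

/-- The contact-scale arithmetic: with `r = ε_N (1 + 1/(K+1))`,
`(N+1)^K · 2^{K+1} · (v₁ (r³ − ε_N³))^K ≤ 2 · (14 v₁ σ³/(K+1))^K`
(`(1+x)³ − 1 ≤ 7x` for `0 ≤ x ≤ 1` and `(N+1) ε_N³ = σ³`). -/
theorem necklace_arith {σ : ℝ} (hσ : 0 ≤ σ) (N K : ℕ) :
    ((N + 1 : ℕ) : ℝ) ^ K * (2 ^ (K + 1) *
        (v₁ * ((hsDiameter σ N * (1 + 1 / (K + 1))) ^ 3 - hsDiameter σ N ^ 3)) ^ K)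
      ≤ 2 * (14 * v₁ * σ ^ 3 / (K + 1)) ^ K := by
  set ε := hsDiameter σ N with hε
  set x : ℝ := 1 / (K + 1) with hx
  have hK0 : (0 : ℝ) < K + 1 := by positivity
  have hN0 : (0 : ℝ) < ((N + 1 : ℕ) : ℝ) := by positivity
  have hx0 : 0 ≤ x := by rw [hx]; positivity
  have hx1 : x ≤ 1 := by rw [hx, div_le_one hK0]; linarith [show (0 : ℝ) ≤ K from Nat.cast_nonneg K]
  have hε0 : 0 ≤ ε := hsDiameter_nonneg' hσ N
  have hε3 : ε ^ 3 = σ ^ 3 / ((N + 1 : ℕ) : ℝ) := hsDiameter_pow_three σ N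
  have hv := v₁_pos
  have hpoly : (1 + x) ^ 3 - 1 ≤ 7 * x := by
    have hfac : (1 + x) ^ 3 - 1 - 7 * x = x * (x + 4) * (x - 1) := by ring
    have hle : x * (x + 4) * (x - 1) ≤ 0 :=
      mul_nonpos_of_nonneg_of_nonpos (mul_nonneg hx0 (by linarith)) (by linarith)
    linarith
  have hkey : v₁ * ((ε * (1 + x)) ^ 3 - ε ^ 3) ≤ 7 * v₁ * σ ^ 3 / ((K + 1) * ((N + 1 : ℕ) : ℝ)) := by
    have h1 : (ε * (1 + x)) ^ 3 - ε ^ 3 = ε ^ 3 * ((1 + x) ^ 3 - 1) := by ring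
    have h2 : ε ^ 3 * ((1 + x) ^ 3 - 1) ≤ ε ^ 3 * (7 * x) :=
      mul_le_mul_of_nonneg_left hpoly (pow_nonneg hε0 3)
    calc v₁ * ((ε * (1 + x)) ^ 3 - ε ^ 3) ≤ v₁ * (ε ^ 3 * (7 * x)) := by
          rw [h1]; exact mul_le_mul_of_nonneg_left h2 hv.le
      _ = 7 * v₁ * σ ^ 3 / ((K + 1) * ((N + 1 : ℕ) : ℝ)) := by
          rw [hε3, hx]; field_simp
  have hnn : 0 ≤ v₁ * ((ε * (1 + x)) ^ 3 - ε ^ 3) := by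
    have h1 : (ε * (1 + x)) ^ 3 - ε ^ 3 = ε ^ 3 * ((1 + x) ^ 3 - 1) := by ring
    rw [h1]
    refine mul_nonneg hv.le (mul_nonneg (pow_nonneg hε0 3) ?_)
    have : 1 ≤ (1 + x) ^ 3 := one_le_pow₀ (by linarith)
    linarith
  calc ((N + 1 : ℕ) : ℝ) ^ K * (2 ^ (K + 1) * (v₁ * ((ε * (1 + x)) ^ 3 - ε ^ 3)) ^ K)
      ≤ ((N + 1 : ℕ) : ℝ) ^ K * (2 ^ (K + 1) * (7 * v₁ * σ ^ 3 / ((K + 1) * ((N + 1 : ℕ) : ℝ))) ^ K) := by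
        gcongr
    _ = 2 * (14 * v₁ * σ ^ 3 / (K + 1)) ^ K := by
        have hn : ((N + 1 : ℕ) : ℝ) ^ K ≠ 0 := pow_ne_zero _ hN0.ne'
        rw [div_mul_eq_div_div, div_pow _ ((N + 1 : ℕ) : ℝ),
          show (14 * v₁ * σ ^ 3 / (K + 1)) = 2 * (7 * v₁ * σ ^ 3 / (K + 1)) by ring, mul_pow, pow_succ,
          mul_div_assoc', mul_div_assoc', mul_comm (((N + 1 : ℕ) : ℝ) ^ K), mul_div_assoc,
          div_self hn, mul_one]
        ring

/-- Casting the necklace bound to `ℝ≥0∞`: `n^K · (2^{K+1} · ofReal(V)^K) = ofReal(n^K · (2^{K+1} · V^K))`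
for `V ≥ 0`. -/
theorem ofReal_necklaceBound (n K : ℕ) {V : ℝ} (hV : 0 ≤ V) :
    ((n : ℕ) : ℝ≥0∞) ^ K * (2 ^ (K + 1) * ENNReal.ofReal V ^ K)
      = ENNReal.ofReal (((n : ℕ) : ℝ) ^ K * (2 ^ (K + 1) * V ^ K)) := by
  rw [ENNReal.ofReal_mul (by positivity), ENNReal.ofReal_mul (by positivity),
    ENNReal.ofReal_pow (Nat.cast_nonneg n), ENNReal.ofReal_natCast,
    ENNReal.ofReal_pow (by norm_num : (0 : ℝ) ≤ 2), ENNReal.ofReal_ofNat, ENNReal.ofReal_pow hV]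

/-- **Contact-scale necklaces** (the static, single-grid-time sub-event of `IsTightChain`): for
`0 < σ < 1/4`, any flow and time, GIVEN the fixed-time chain bound `hchain` (prelim 1/2), for every end
label `i` the `G_N`-probability that `K + 1` distinct particles ending at `i` have consecutive minimal-image distances
`≤ ε_N (1 + 1/(K+1))` at time `t` is at most `2 · (14 v₁ σ³/(K+1))^K`, uniformly in `N`, `t`, `Φ`, `i`:
a `G_N`-cost `≥ K · log((K+1)/(14 v₁ σ³)) − log 2` per static necklace of `K` links. -/
theorem gibbs_tightNecklaceAt_le_of_chainBound {σ a θ : ℝ} (u₀ : V3) (hσ : 0 < σ) (hσ4 : σ < 1 / 4)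
    {N K : ℕ} (Φ : Flow σ N) (t : ℝ)
    (hchain : ∀ (j : Fin (K + 1) → Fin (N + 1)), Function.Injective j → ∀ (B : Fin K → Set T3),
      (∀ m, MeasurableSet (B m)) → gibbs σ a θ u₀ N Φ {z : Phase N | ∀ m : Fin K,
        (Φ.flow t z (j m.succ)).1 - (Φ.flow t z (j m.castSucc)).1 ∈ B m} ≤ 2 ^ (K + 1) * ∏ m, volume (B m))
    (i : Fin (N + 1)) :
    gibbs σ a θ u₀ N Φ {z : Phase N | ∃ j : Fin (K + 1) → Fin (N + 1), Function.Injective j ∧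
        j (Fin.last K) = i ∧ ∀ m : Fin K,
          Torus.euclidDist (Φ.flow t z (j m.succ)).1 (Φ.flow t z (j m.castSucc)).1
            ≤ hsDiameter σ N * (1 + 1 / (K + 1))}
      ≤ ENNReal.ofReal (2 * (14 * v₁ * σ ^ 3 / (K + 1)) ^ K) := by
  have hK0 : (0 : ℝ) < K + 1 := by positivity
  have hr : hsDiameter σ N * (1 + 1 / (K + 1)) < 1 / 2 := by
    have h1 : 1 / ((K : ℝ) + 1) ≤ 1 := by
      rw [div_le_one hK0]
      linarith [show (0 : ℝ) ≤ K from Nat.cast_nonneg K]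
    have h2 := hsDiameter_le hσ.le N
    have h3 := hsDiameter_pos hσ N
    nlinarith
  refine (gibbs_necklaceAt_le_of_chainBound σ a θ u₀ hσ.le N K Φ t _ hr hchain i).trans ?_
  have hv := v₁_pos
  have hnn : 0 ≤ v₁ * ((hsDiameter σ N * (1 + 1 / (K + 1))) ^ 3 - hsDiameter σ N ^ 3) := by
    have hε0 := (hsDiameter_pos hσ N).le
    have h1 : (hsDiameter σ N * (1 + 1 / (K + 1))) ^ 3 - hsDiameter σ N ^ 3
        = hsDiameter σ N ^ 3 * ((1 + 1 / (K + 1)) ^ 3 - 1) := by ring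
    rw [h1]
    refine mul_nonneg hv.le (mul_nonneg (pow_nonneg hε0 3) ?_)
    have : 1 ≤ (1 + 1 / ((K : ℝ) + 1)) ^ 3 := one_le_pow₀ (by
      have : (0 : ℝ) ≤ 1 / (K + 1) := by positivity
      linarith)
    linarith
  rw [ofReal_necklaceBound (N + 1) K hnn]
  exact ENNReal.ofReal_le_ofReal (necklace_arith hσ.le N K)


/-! ## Slack concentration: the last link can carry the whole `w`-slack -/

/-- **Slack concentration** (why the single-time engine cannot be the whole story, and the witness
against thresholds `K ≥ C(1+w)` in `TightChainPressure`): on the good set, if the first `K` particles of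
an injective sequence `j` (with `j K = i`) form a STATIC necklace at time `0` — consecutive minimal-image
distances `≤ ε_N (1 + 1/(K+1))` — and the time-`Tℓ` position of `i` lies within
`ε_N (1 + 1/(K+1)) + w · Tℓ` of the time-`0` position of `j (K-1)`, then `i` ends a tight anchored
`w`-chain of `K` links (grid times `q = (0, …, 0, 1)`): the whole `w`-slack is spent on the last link, so
every particle in a ball of radius `≈ w T ℓ` around the end of one static necklace is a chain end. -/
theorem isTightChain_of_staticNecklace {σ T : ℝ} {N K : ℕ} (Φ : Flow σ N) (w : ℝ) {z : Phase N}
    (hz : z ∈ Φ.good) {i : Fin (N + 1)} (j : Fin (K + 1) → Fin (N + 1)) (hj : Function.Injective j)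
    (hji : j (Fin.last K) = i)
    (hstatic : ∀ m : Fin K, m.succ ≠ Fin.last K →
      Torus.euclidDist (z (j m.succ)).1 (z (j m.castSucc)).1 ≤ hsDiameter σ N * (1 + 1 / (K + 1)))
    (hlast : ∀ m : Fin K, m.succ = Fin.last K →
      Torus.euclidDist (Φ.flow (T * ell N) z (j m.succ)).1 (z (j m.castSucc)).1
        ≤ hsDiameter σ N * (1 + 1 / (K + 1)) + w * (T * ell N)) :
    IsTightChain σ T N Φ w K z i := by
  refine ⟨j, fun m => if m = Fin.last K then 1 else 0, hj, hji, ?_, ?_, ?_⟩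
  · intro m m' hmm'
    by_cases hm : m = Fin.last K
    · have hm' : m' = Fin.last K := Fin.last_le_iff.1 (hm ▸ hmm')
      simp [hm, hm']
    · by_cases hm' : m' = Fin.last K
      · simp [hm, hm']
      · simp [hm, hm']
  · intro m
    by_cases hm : m = Fin.last K
    · simp [hm]
    · simp [hm]
  · intro m
    have hcs : m.castSucc ≠ Fin.last K := (Fin.castSucc_lt_last m).ne
    have h0 : Φ.flow (T * ell N * ((0 : ℚ) : ℝ)) z = z := by
      rw [Rat.cast_zero, mul_zero, Φ.flow_zero z hz]
    by_cases hm : m.succ = Fin.last K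
    · simp only [hm, hcs, if_true, if_false]
      rw [h0, Rat.cast_one, Rat.cast_zero, sub_zero, mul_one]
      have := hlast m hm
      rwa [hm] at this
    · simp only [hm, hcs, if_false]
      rw [h0, Rat.cast_zero, sub_zero, mul_zero, mul_zero, add_zero]
      exact hstatic m hm

end

end Summit.AtomisticToContinuum.HydrodynamicLimit.Theorems.TrueAnchoredInfection
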